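import Mathlib.AlgebraicGeometry.EllipticCurve.Affine.Point
import Mathlib.FieldTheory.AbsoluteGaloisGroup
import Mathlib.FieldTheory.Galois.Infinite
import Mathlib.FieldTheory.KrullTopology
import Mathlib.Algebra.Module.Torsion.Basic
import Mathlib.RepresentationTheory.Continuous.Basic
import Mathlib.RepresentationTheory.Continuous.TopRep
import Mathlib.RepresentationTheory.Homological.ContCohomology.Basic
import Mathlib.RepresentationTheory.Homological.ContCohomology.Functoriality
import HarnessLib

-- provenance: harness21/H21/H21/Prelude/TranscendEllArithS/GaloisAction.lean @ 8dffb85 (interim HEAD d8f2665); M5 mechanical rewrite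
/-!
# Galois action on points of a Weierstrass curve, torsion Galois modules, and continuous-`H¹` glue

Trunk T-ELLARITH (group G06, outline item C17 `GaloisAction`); notions
`galois_action_on_points`, `galois_image_conditions`, and the glue consumed by `sha_group`.

## Contents

* For a Weierstrass curve `W` over a field `F` and a field extension `L/F`, the group
  `L ≃ₐ[F] L` acts on the `L`-rational points `(W.baseChange L).toAffine.Point` by transport of
  coordinates, `σ • P := WeierstrassCurve.Affine.Point.map ↑σ P` (Silverman, *AEC*, III.§1–2, VIII.§1).
  This is a `DistribMulAction` (fully proved).
* `WeierstrassCurve.geomPoints W`: the type synonym `E(F̄)` of points over `AlgebraicClosure F`, with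
  the discrete topology and the action of the absolute Galois group `Field.absoluteGaloisGroup F`;
  Galois descent `E(F̄)^{Γ_F} = E(F)` for `F` perfect (`fixedPoints_eq_range_map`, discharged by
  `fixedPoints_eq_range_map_holds`, Silverman *AEC* I.§1, VIII.§1).
* `WeierstrassCurve.torsionPoints W L n = E(L)[n]`, reusing Mathlib's `AddSubgroup.torsionBy`
  (notation `A[n]`, with `n : ℤ`); the Galois action restricts to it; `WeierstrassCurve.geomTorsion`,
  the mod-`n` Galois representation `WeierstrassCurve.galoisRepTorsion : Γ_F →* AddAut E[n]`
  (Silverman, *AEC*, III.§7; Serre 1972, §4) and the image conditions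
  `HasSurjectiveModNGaloisRep`, `HasIrreducibleModPGaloisRep`.
* Generic glue (namespace `Literature`) turning a discrete `DistribMulAction G M` of a topological group into
  Mathlib's `ContRepresentation ℤ G M` / `TopRep ℤ G`, the type `discreteH1 G M := H¹_cont(G, M)`
  (Mathlib `continuousCohomology 1`), and the kernel `resKer` of a restriction map
  `H¹(G, M) → H¹(H, N)` built with Mathlib's `ContinuousCohomology.map`
  (Serre, *Galois Cohomology*, I.§2.2; Neukirch–Schmidt–Wingberg, (1.2) and II.§7 continuous cochains).

## Mathlib reuse

Continuous group cohomology and its functoriality are Mathlib's (`continuousCohomology`,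
`ContinuousCohomology.map`, `map_id`, `map_comp`); torsion subgroups are `AddSubgroup.torsionBy`
(and `AddSubgroup.torsionBy.zmodModule` makes `E[n]` a `ZMod n`-module, so that `AddAut E[p]` may be
read as `GL₂(𝔽_p)` once a basis is chosen); the Krull topology on `Field.absoluteGaloisGroup` is
Mathlib's; `Affine.Point.map`, `map_id`, `map_map` provide the action.

## Design choices

* Group-wide rules: `noncomputable section`, `open scoped Classical`, no `[DecidableEq]` variables
  (the `AddCommGroup` structure on points depends on a `DecidableEq` instance).
* Universes: `F L G M H N : Type u` in one named universe, because `ContinuousCohomology.map` needs the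
  two groups in the same universe; `geomPoints W : Type u` explicitly.
* `geomPoints` is a `def` (type synonym), not an `abbrev`, so that the discrete topology put on it does
  not leak to Mathlib's `Point` type. Since `Field.absoluteGaloisGroup` is itself a `def`, the
  `Γ_F`-action on `geomPoints W` is declared explicitly via `inferInstanceAs`.
* In this Mathlib `AddAut A` carries an *additive* group structure, and
  `DistribMulAction.toAddAut : G →* Multiplicative (AddAut A)`; `galoisRepTorsion` therefore lands in
  `Multiplicative (AddAut _)`.
* Continuity of the mod-`n` representation is stated as openness of its kernel
  (`isOpen_ker_galoisRepTorsion`), equivalent to continuity for the discrete finite target and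
  avoiding a topology instance on `AddAut`.
* Declarations specific to Weierstrass curves are deliberate dot-notation extensions in
  `namespace WeierstrassCurve`; the generic glue lives in `namespace Literature`.
-/

noncomputable section

open scoped Classical
open scoped AddSubgroup

universe u

/-! ## Generic glue: group actions restrict to torsion subgroups -/

namespace Literature.NumberTheory.EllipticCurves

section TorsionAction

variable {G : Type*} {A : Type*} [Monoid G] [AddCommGroup A] [DistribMulAction G A]

/-- If a monoid `G` acts distributively on an abelian group `A`, then the `n`-torsion subgroup
`A[n]` is stable under the action (the action commutes with multiplication by `n : ℤ`).
Silverman, *AEC*, III.§7 (for `A = E(K̄)`). [folklore] -/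
theorem smul_mem_torsionBy {n : ℤ} (g : G) {a : A} (ha : a ∈ A[n]) : g • a ∈ A[n] := by
  rw [AddSubgroup.torsionBy, Submodule.mem_toAddSubgroup, Submodule.mem_torsionBy_iff] at ha ⊢
  rw [smul_comm, ha, smul_zero]

/-- The distributive action of `G` on `A` restricts to the `n`-torsion subgroup `A[n]`
(`(g • a : A) = g • (a : A)`). Silverman, *AEC*, III.§7. [folklore] -/
instance AddSubgroup.torsionBy.instDistribMulAction (n : ℤ) : DistribMulAction G (A[n]) where
  smul g a := ⟨g • (a : A), smul_mem_torsionBy g a.2⟩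
  one_smul a := Subtype.ext (one_smul G (a : A))
  mul_smul g h a := Subtype.ext (mul_smul g h (a : A))
  smul_zero g := Subtype.ext (smul_zero g)
  smul_add g a b := Subtype.ext (smul_add g (a : A) b)

/-- Unfolding lemma for the restricted action on `A[n]`. Silverman, *AEC*, III.§7. [folklore] -/
@[simp]
theorem AddSubgroup.torsionBy.coe_smul {n : ℤ} (g : G) (a : A[n]) :
    ((g • a : A[n]) : A) = g • (a : A) :=
  rfl

end TorsionAction

end Literature.NumberTheory.EllipticCurves

/-! ## The Galois action on rational points -/

namespace WeierstrassCurve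

variable {F : Type u} [Field F] (W : WeierstrassCurve F) (L : Type u) [Field L] [Algebra F L]

/-- The Galois action on `L`-rational points: `Aut(L/F)` acts on `E(L) = (W.baseChange L).Point`
by applying `σ` to the coordinates, `σ • P := Affine.Point.map ↑σ P`. It is an action by group
automorphisms. Silverman, *AEC*, VIII.§1 (and III.§1–2 for base change of points). [folklore] -/
instance instDistribMulActionAlgEquivPoint :
    DistribMulAction (L ≃ₐ[F] L) (W.baseChange L).toAffine.Point where
  smul σ P := Affine.Point.map (σ : L →ₐ[F] L) P
  one_smul P := by
    change Affine.Point.map _ P = P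
    exact Affine.Point.map_id P
  mul_smul σ τ P := by
    change Affine.Point.map _ P = Affine.Point.map _ (Affine.Point.map _ P)
    rw [Affine.Point.map_map]
    rfl
  smul_zero σ := map_zero _
  smul_add σ P Q := map_add _ P Q

/-- Unfolding the Galois action on points: `σ • P = Affine.Point.map ↑σ P`.
Silverman, *AEC*, VIII.§1. [folklore] -/
theorem smul_def (σ : L ≃ₐ[F] L) (P : (W.baseChange L).toAffine.Point) :
    σ • P = Affine.Point.map (σ : L →ₐ[F] L) P :=
  rfl

/-! ## Geometric points `E(F̄)` as a discrete `Γ_F`-module -/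

/-- The geometric points `E(F̄)` of `W`: the (type synonym for the) group of points of `W` over
`AlgebraicClosure F`. A `def`, so that the discrete topology below stays local to this synonym.
Silverman, *AEC*, VIII.§1. [folklore] -/
def geomPoints (W : WeierstrassCurve F) : Type u :=
  (W.baseChange (AlgebraicClosure F)).toAffine.Point

/-- `E(F̄)` is an abelian group (Mathlib's group law on nonsingular points).
Silverman, *AEC*, III.§2. [folklore] -/
instance geomPoints.instAddCommGroup : AddCommGroup (geomPoints W) :=
  inferInstanceAs (AddCommGroup (W.baseChange (AlgebraicClosure F)).toAffine.Point)

/-- `E(F̄)` carries the discrete topology (it is a discrete `Γ_F`-module).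
Serre, *Galois Cohomology*, I.§2.2 and II.§1. [folklore] -/
instance geomPoints.instTopologicalSpace : TopologicalSpace (geomPoints W) := ⊥

/-- The topology on `E(F̄)` is discrete by definition. Serre, *Galois Cohomology*, II.§1. [folklore] -/
instance geomPoints.instDiscreteTopology : DiscreteTopology (geomPoints W) := ⟨rfl⟩

/-- The absolute Galois group `Γ_F = Gal(F̄/F)` acts on `E(F̄)` through its action on coordinates.
Declared explicitly because `Field.absoluteGaloisGroup` is a `def`.
Silverman, *AEC*, VIII.§1. [folklore] -/
instance geomPoints.instDistribMulActionAbsoluteGaloisGroup :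
    DistribMulAction (Field.absoluteGaloisGroup F) (geomPoints W) :=
  inferInstanceAs (DistribMulAction (AlgebraicClosure F ≃ₐ[F] AlgebraicClosure F)
    (W.baseChange (AlgebraicClosure F)).toAffine.Point)

/-- The stabiliser in `Γ_F` of a geometric point is open for the Krull topology (it contains
`Gal(F̄/F(P))` with `F(P)/F` finite), i.e. `E(F̄)` is a discrete `Γ_F`-module.
Serre, *Galois Cohomology*, II.§1; Silverman, *AEC*, VIII.§1. [cite: SerreGaloisCohomology1997, II.§1 (discrete Galois modules); Silverman AEC VIII.§1] -/
def isOpen_stabilizer_point : Prop :=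
  ∀ (P : geomPoints W),
    IsOpen ((MulAction.stabilizer (Field.absoluteGaloisGroup F) P : Subgroup _) :
      Set (Field.absoluteGaloisGroup F))

/-- Galois descent for points over a perfect field: `E(F̄)^{Γ_F} = E(F)`, i.e. the `Γ_F`-fixed
points of `E(F̄)` are exactly the image of the `F`-rational points under base change. (Over an
imperfect field the fixed points are the points over the perfect closure, whence `[PerfectField F]`.)
Silverman, *AEC*, VIII.§1 (proof of Prop. 1.2); Serre, *Galois Cohomology*, II.§1. [cite: SilvermanAEC2009, VIII.§1 (proof of Prop. 1.2)] -/
def fixedPoints_eq_range_map : Prop :=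
  ∀ [PerfectField F],
    MulAction.fixedPoints (Field.absoluteGaloisGroup F) (geomPoints W) =
      Set.range (fun P : (W.baseChange F).toAffine.Point =>
        (Affine.Point.baseChange F (AlgebraicClosure F) P : geomPoints W))

/-! ## Torsion points as Galois modules -/

/-- The `n`-torsion subgroup `E(L)[n] = {P ∈ E(L) | n • P = 0}` of the `L`-rational points, for
`n : ℤ`; this is Mathlib's `AddSubgroup.torsionBy` (notation `A[n]`), and
`AddSubgroup.torsionBy.zmodModule` makes it a `ZMod n`-module. Silverman, *AEC*, III.§6. [folklore] -/
abbrev torsionPoints (n : ℤ) : AddSubgroup (W.baseChange L).toAffine.Point :=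
  AddSubgroup.torsionBy _ n

/-- Membership in `E(L)[n]`: `P ∈ E(L)[n] ↔ n • P = 0`. Silverman, *AEC*, III.§6. [folklore] -/
theorem mem_torsionPoints_iff {n : ℤ} (P : (W.baseChange L).toAffine.Point) :
    P ∈ torsionPoints W L n ↔ n • P = 0 :=
  Submodule.mem_torsionBy_iff n P

/-- `E(L)[n]` is stable under `Aut(L/F)`. Silverman, *AEC*, III.§7. [folklore] -/
theorem smul_mem_torsionPoints {n : ℤ} (σ : L ≃ₐ[F] L) {P : (W.baseChange L).toAffine.Point}
    (hP : P ∈ torsionPoints W L n) : σ • P ∈ torsionPoints W L n :=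
  Literature.NumberTheory.EllipticCurves.smul_mem_torsionBy σ hP

/-- For an elliptic curve, `E(L)[n]` is finite for `n ≠ 0` (it has at most `n²` elements).
Silverman, *AEC*, III.6.4. [cite: SilvermanAEC2009, Cor. III.6.4] -/
def finite_torsionPoints : Prop :=
  ∀ [W.IsElliptic] {n : ℤ} (hn : n ≠ 0),
    Finite (torsionPoints W L n)

/-- For an elliptic curve over an algebraically closed field `L` and `n` invertible in `L`,
`E(L)[n] ≅ (ℤ/nℤ)²`, in particular `#E(L)[n] = n²`. Silverman, *AEC*, III.6.4(b). [cite: SilvermanAEC2009, Cor. III.6.4(b)] -/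
def card_torsionPoints_eq_sq : Prop :=
  ∀ [W.IsElliptic] [IsAlgClosed L] {n : ℕ} (hn : (n : L) ≠ 0),
    Nat.card (torsionPoints W L n) = n ^ 2

/-- The geometric `n`-torsion `E[n] = E(F̄)[n]` as a subgroup of `geomPoints W`, with the induced
action of `Γ_F` (instance `Literature.NumberTheory.EllipticCurves.AddSubgroup.torsionBy.instDistribMulAction`).
Silverman, *AEC*, III.§7. [folklore] -/
abbrev geomTorsion (n : ℤ) : AddSubgroup (geomPoints W) :=
  AddSubgroup.torsionBy (geomPoints W) n

/-- The mod-`n` Galois representation `ρ̄_{E,n} : Γ_F → Aut(E[n])` attached to `W`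
(Mathlib's `DistribMulAction.toAddAut`; the target is `Multiplicative (AddAut E[n])` because
`AddAut` is an additive group in Mathlib). With `AddSubgroup.torsionBy.zmodModule` and a basis of
`E[n] ≅ (ℤ/nℤ)²` this is the classical `Γ_F → GL₂(ℤ/nℤ)`.
Silverman, *AEC*, III.§7; Serre (1972), §4. [cite: Serre1972] -/
def galoisRepTorsion (n : ℤ) :
    Field.absoluteGaloisGroup F →* Multiplicative (AddAut (geomTorsion W n)) :=
  DistribMulAction.toAddAut (Field.absoluteGaloisGroup F) (geomTorsion W n)

/-- Unfolding `galoisRepTorsion`: `ρ̄(σ) P = σ • P`. Silverman, *AEC*, III.§7. [folklore] -/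
@[simp]
theorem galoisRepTorsion_apply (n : ℤ) (σ : Field.absoluteGaloisGroup F) (P : geomTorsion W n) :
    (galoisRepTorsion W n σ).toAdd P = σ • P :=
  rfl

/-- The mod-`n` Galois representation of an elliptic curve is continuous for the Krull topology on
`Γ_F` and the discrete topology on the finite group `Aut(E[n])` (`n ≠ 0`); equivalently, its kernel
`Gal(F̄/F(E[n]))` is open. Silverman, *AEC*, III.§7 and VIII.§1; Serre (1972), §4. [cite: Serre1972] -/
def isOpen_ker_galoisRepTorsion : Prop :=
  ∀ [W.IsElliptic] {n : ℤ} (hn : n ≠ 0),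
    IsOpen ((galoisRepTorsion W n).ker : Set (Field.absoluteGaloisGroup F))

/-! ## Image conditions on the mod-`n` representation -/

/-- The condition "the mod-`n` Galois representation `ρ̄_{E,n} : Γ_F → Aut(E[n])` is surjective"
(for `n` invertible in `F` and `W` elliptic, `Aut(E[n]) ≅ GL₂(ℤ/nℤ)`). Serre (1972), §4. [cite: Serre1972] -/
def HasSurjectiveModNGaloisRep (n : ℤ) : Prop :=
  Function.Surjective (galoisRepTorsion W n)

/-- The condition "the mod-`p` Galois representation is irreducible": the only `Γ_F`-stable
subgroups of `E[p]` are `⊥` and `⊤` (for `p` prime every additive subgroup of the `𝔽_p`-vector space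
`E[p]` is a subspace, so this is irreducibility of `ρ̄_{E,p} : Γ_F → GL₂(𝔽_p)`).
Serre (1972), §4; Silverman, *AEC*, III.§7. [cite: Serre1972] -/
def HasIrreducibleModPGaloisRep (p : ℕ) : Prop :=
  ∀ H : AddSubgroup (geomTorsion W p),
    (∀ σ : Field.absoluteGaloisGroup F, ∀ P ∈ H, σ • P ∈ H) → H = ⊥ ∨ H = ⊤

end WeierstrassCurve

/-! ## Glue to Mathlib's continuous group cohomology -/

namespace Literature.NumberTheory.EllipticCurves

section H1

variable (G : Type u) [Group G] [TopologicalSpace G] [IsTopologicalGroup G]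
variable (M : Type u) [AddCommGroup M] [DistribMulAction G M] [TopologicalSpace M]
  [DiscreteTopology M]

/-- A discrete `G`-module `M` (a `DistribMulAction` of a topological group on a discrete abelian
group) as a continuous `ℤ`-linear representation in Mathlib's sense (`ContRepresentation.ofMonoidHom`;
each `g` acts by a continuous map since `M` is discrete). Serre, *Galois Cohomology*, I.§2.2;
Neukirch–Schmidt–Wingberg, (1.2). [folklore] -/
def discreteContRep : ContRepresentation ℤ G M :=
  ContRepresentation.ofMonoidHom
    { toFun := fun g ↦
        { toLinearMap := (DistribSMul.toAddMonoidHom M g).toIntLinearMap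
          cont := continuous_of_discreteTopology }
      map_one' := by ext m; simp
      map_mul' := fun g h ↦ by ext m; simp [mul_smul] }

/-- The discrete `G`-module `M` as an object of Mathlib's category `TopRep ℤ G`.
Serre, *Galois Cohomology*, I.§2.2. [folklore] -/
abbrev discreteTopRep : TopRep ℤ G := TopRep.of (discreteContRep G M)

/-- The continuous cohomology group `H¹_cont(G, M)` of the discrete `G`-module `M`, as a type
(Mathlib's `continuousCohomology 1`, a `TopModuleCat ℤ`, coerced to its carrier; it is an
`AddCommGroup`). Serre, *Galois Cohomology*, I.§2.2; Neukirch–Schmidt–Wingberg, II.§7. [folklore] -/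
abbrev discreteH1 : Type u := continuousCohomology 1 (discreteTopRep G M)

variable (H : Type u) [Group H] [TopologicalSpace H] [IsTopologicalGroup H]
variable (N : Type u) [AddCommGroup N] [DistribMulAction H N] [TopologicalSpace N]
  [DiscreteTopology N]

variable {G M H N}

/-- Given a continuous homomorphism `φ : H → G` and an additive map `ψ : M → N` compatible with the
actions (`ψ (φ x • m) = x • ψ m`), the morphism `res_φ M ⟶ N` in `TopRep ℤ H` inducing the map
`H¹(G, M) → H¹(H, N)` on cohomology. Serre, *Galois Cohomology*, I.§2.4 (compatible pairs);
Neukirch–Schmidt–Wingberg, I.§5. [folklore] -/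
def resHomOfEquivariant (φ : H →ₜ* G) (ψ : M →+ N)
    (h : ∀ (x : H) (m : M), ψ (φ x • m) = x • ψ m) :
    TopRep.res (φ : H →* G) (discreteTopRep G M) ⟶ discreteTopRep H N :=
  TopRep.ofHom
    { toLinearMap := ψ.toIntLinearMap
      cont := continuous_of_discreteTopology (α := M)
      isIntertwining' := fun x ↦ by ext m; exact h x m }

/-- The kernel of the map `H¹_cont(G, M) → H¹_cont(H, N)` induced by a compatible pair `(φ, ψ)`
(Mathlib's `ContinuousCohomology.map`). For `φ` the inclusion of a decomposition group this is the
local condition defining the Tate–Shafarevich group. Serre, *Galois Cohomology*, I.§2.4;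
Silverman, *AEC*, X.§4. [folklore] -/
def resKer (φ : H →ₜ* G) (ψ : M →+ N)
    (h : ∀ (x : H) (m : M), ψ (φ x • m) = x • ψ m) : AddSubgroup (discreteH1 G M) :=
  (ContinuousCohomology.map φ (resHomOfEquivariant φ ψ h) 1).hom.toLinearMap.toAddMonoidHom.ker

end H1

end Literature.NumberTheory.EllipticCurves

/-! ## Discharge: Galois descent for points -/

namespace WeierstrassCurve

variable {F : Type u} [Field F] (W : WeierstrassCurve F)

/-- **Discharge of `fixedPoints_eq_range_map`** (Galois descent for points, `E(F̄)^{Γ_F} = E(F)` for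
`F` perfect). Proof as in the source: `⊇` because `σ` fixes coordinates coming from `F`
(`Affine.Point.map_baseChange`); `⊆` because a fixed affine point `(x, y)` has `σ x = x`, `σ y = y`
for all `σ ∈ Gal(F̄/F)`, and since `F` is perfect `F̄/F` is Galois, so `x, y ∈ F`
(Mathlib `InfiniteGalois.mem_range_algebraMap_iff_fixed`); the point `O` is `baseChange O`.
Silverman, *AEC* (2009), I.§1, "V(K) = {P ∈ V : P^σ = P for all σ ∈ G_{K̄/K}}" (K perfect, standing
hypothesis of Ch. I), used in VIII.§1–2 as `H⁰(G_{K̄/K}, E(K̄)) = E(K)`.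
[cite: SilvermanAEC2009, I.§1 and VIII.§1 (proof of Prop. 1.2)] -/
theorem fixedPoints_eq_range_map_holds : fixedPoints_eq_range_map W := by
  intro _
  haveI : IsGalois F (AlgebraicClosure F) := {}
  ext P
  simp only [MulAction.mem_fixedPoints]
  constructor
  · intro hP
    change (W.baseChange (AlgebraicClosure F)).toAffine.Point at P
    rcases P with _ | ⟨x, y, h⟩
    · exact ⟨0, rfl⟩
    · have hxy : ∀ σ : AlgebraicClosure F ≃ₐ[F] AlgebraicClosure F, σ x = x ∧ σ y = y := by
        intro σ
        have := hP σ
        change Affine.Point.map (σ : AlgebraicClosure F →ₐ[F] AlgebraicClosure F)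
          (Affine.Point.some x y h) = Affine.Point.some x y h at this
        rw [Affine.Point.map_some] at this
        simpa only [Affine.Point.some.injEq, AlgEquiv.coe_toAlgHom] using this
      obtain ⟨x₀, rfl⟩ :=
        (InfiniteGalois.mem_range_algebraMap_iff_fixed x).mpr fun σ => (hxy σ).1
      obtain ⟨y₀, rfl⟩ :=
        (InfiniteGalois.mem_range_algebraMap_iff_fixed y).mpr fun σ => (hxy σ).2
      have h₀ : (W.baseChange F).toAffine.Nonsingular x₀ y₀ :=
        (Affine.baseChange_nonsingular W (Algebra.ofId F (AlgebraicClosure F)).injective x₀ y₀).mp h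
      exact ⟨Affine.Point.some x₀ y₀ h₀, rfl⟩
  · rintro ⟨P, rfl⟩ σ
    change Affine.Point.map
      ((show AlgebraicClosure F ≃ₐ[F] AlgebraicClosure F from σ) :
        AlgebraicClosure F →ₐ[F] AlgebraicClosure F)
      (Affine.Point.baseChange F (AlgebraicClosure F) P) = _
    exact Affine.Point.map_baseChange _ P

end WeierstrassCurve
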